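import Literature.Computability.AlgebraicComplexity.DepthReduction
import Literature.Computability.AlgebraicComplexity.ArithCircuitProofs
import Literature.Computability.AlgebraicComplexity.GateQuotients
import Mathlib.Data.Finsupp.Multiset
import Mathlib.Data.Sym.Card
import Mathlib.Data.Nat.Choose.Bounds

/-!
# Tavenas' depth reduction for `VP` families — discharge of the named fact

Discharge (D-0014) of `Literature.Computability.AlgebraicComplexity.productDepthCircuitSize_two_le_of_isVPFamily`
(`DepthReduction.lean`: Tavenas, *Improved bounds for reduction to depth 4 and depth 3*,
Inform. and Comput. 240 (2015), Thm. 1, specialised to p-bounded size and degree, in the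
product-depth model of Limaye–Srinivasan–Tavenas 2021):
`Literature.Computability.AlgebraicComplexity.productDepthCircuitSize_two_le_of_isVPFamily_holds`, obtained from
`Literature.Computability.AlgebraicComplexity.DepthReduction.productDepthCircuitSize_two_le`, which proves the statement over
every commutative semiring.

The algebra of the printed proof (homogenization, the Valiant–Skyum–Berkowitz–Rackoff gate
quotients, the `×`-balanced expansion of Agrawal–Vinay; Tavenas §4–§6) lives in
`GateQuotients.lean`, whose structural theorem `SLP.exists_sum_prod` says: a value of total
degree `≤ d` of a straight-line program of length `L` is, for every `t ≥ 1`, a sum of at most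
`(d+1)·(S·S)^{⌊8d/(t+1)⌋}` products of at most `1 + 4⌊8d/(t+1)⌋` polynomials of total degree
`≤ t`, `S = 4L(d+1)²`. This file supplies the plumbing in the tree's list-based circuit model
`Literature.Computability.AlgebraicComplexity.ArithCircuit` (`ArithCircuit.lean`, `CircuitDepth.lean`) and the final count.

## Contents

* Extraction (`toSOperand`, `toSLine`, `slpOf`, `exists_slp`): a fan-in-two circuit of size
  `s` computing `g` — one of size `complexity g` exists by
  `ArithCircuit.exists_computes_size_eq_complexity` (`ArithCircuitProofs.lean`) — is read as
  a straight-line program of length `s` (Bürgisser 2000, Def. 2.1; `GateQuotients.SLP`) one of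
  whose values is `g`, unless the output operand is a variable or a constant (then `g` has a
  circuit without gates). `getElem?_gateValues` is the gate-by-gate semantics of `gateValues`.
* The `ΣΠΣΠ` builder (`monomialGate`, `layerM`, `pieceGate`, `layerP`, `layerT`, `topGate`,
  `sigmaPiCircuit`, `exists_circuit_sum_prod`): `Σ_{τ<T} Π_{π<W} p τ π`, with all supports in
  a finite set `U` of monomials, has an unbounded-fan-in circuit of product-depth `≤ 2`
  (`ArithCircuit.productDepth`) with `#U + T·W + T + 1` gates — one `×`-gate per monomial of
  `U`, one weighted `+`-gate per polynomial `p τ π`, one `×`-gate per `τ`, one output `+`-gate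
  (Tavenas §6, proof of Lemma 3: "the `1` encodes the `+`-gate, the `n` encodes the input
  gates, and the remainder encodes the `×`-gates"; a `ΣΠΣΠ` circuit in the sense of §2; in
  the tree's model inputs are operands, not gates). Layer bookkeeping for values and product
  depths: `gateValues_layer`, `gateWDepths_layer` (a gate whose operands refer to an earlier
  layer is evaluated against that layer only).
* Counting and arithmetic: `card_le_of_degree_le` (at most `(t+1)(N+t)^t` monomials of degree
  `≤ t` in `N` variables, `t ≥ 1`; Tavenas uses `binom(n + d/a, d/a)`), `sizeBound`,
  `exists_circuit_of_slp` (a value of degree `≤ d` of a straight-line program of length `s`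
  over `N` variables has a product-depth-`2` circuit with `≤ sizeBound N d s t` gates) and
  `sizeBound_le`: if `t+1, N+t, d+1, s ≤ B^E`, `d < (t+1)²` and `B ≥ 2` then
  `sizeBound N d s t ≤ B^{(48E+32)t + 50E+40}`.
* `productDepthCircuitSize_two_le`: for a `VP` family with `#σₙ ≤ n^{a₁}+a₁`,
  `deg fₙ ≤ n^{a₂}+a₂`, `complexity fₙ ≤ n^{a₃}+a₃` take `B = n+2`, `E = a₁+a₂+a₃+2`,
  `t = ⌊√(deg fₙ)⌋`; the constant of the fact is `c = 50E + 40` (degree `0` and the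
  variable/constant outputs are the gate-free cases).

## Comparison with the printed theorem

Tavenas' conclusion is a homogeneous `ΣΠ^{[O(α)]}ΣΠ^{[β]}` circuit of size
`2^{O(√(d log(ds) log n))}`; the named fact keeps only "product-depth `≤ 2`" and the size
specialised to p-bounded `s, d`, namely `(n+2)^{c√d + c}` gates. The proof here reaches that
bound through the Agrawal–Vinay/Koiran form `s^{O(√d)}` of the exponent (at most
`(d+1)(S·S)^{8(√d+1)}` products of `O(√d)` factors of degree `≤ √d` each, `S = 4s(d+1)²`),
which coincides with Tavenas' bound after the specialisation; nothing is asserted beyond the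
fact as vendored.

## Related files

`HomogeneousCircuits.lean` defines the tree's *syntactic* notion of a homogeneous circuit
(`ArithCircuit.IsHomogeneousCircuit`, `homProductDepthCircuitSize`) and
`TavenasHomogeneous.lean` vendors the homogeneous form of the same theorem
(`homProductDepthCircuitSize_two_le_of_isVPFamily`). The certificates `HomCircuit` of
`GateQuotients.lean` are a different object — a value assignment with formal degrees
satisfying the local equations of a homogenized straight-line program, whose values need not
be homogeneous polynomials — used here only as the carrier of the gate-quotient expansion;
`SLP.exists_sum_prod_component` (products of homogeneous components) is the natural input
for discharging the homogeneous fact as well, which is not done in this file.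

## References

* S. Tavenas, *Improved bounds for reduction to depth 4 and depth 3*, Inform. and Comput. 240
  (2015) 2–11; MFCS 2013, LNCS 8087, 813–824 (arXiv:1304.5777): Thm. 1, Lemma 3 and its proof
  (§6), §2 (`ΣΠΣΠ` circuits).
* M. Agrawal, V. Vinay, *Arithmetic circuits: a chasm at depth four*, FOCS 2008, 67–75.
* P. Bürgisser, *Completeness and Reduction in Algebraic Complexity Theory*, Springer 2000,
  Def. 2.1 (straight-line programs, `complexity`), Def. 2.3–2.4 (`VP`).
* N. Limaye, S. Srinivasan, S. Tavenas, *Superpolynomial lower bounds against low-depth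
  algebraic circuits*, FOCS 2021, §1 (product depth).
-/

/-! ## Circuit plumbing in the list-based `ArithCircuit` model -/

noncomputable section

open MvPolynomial

namespace Literature.Computability.AlgebraicComplexity.DepthReduction

universe u v

variable {k : Type u} {σ : Type v}

open ArithCircuit


/-! ### Extraction of a straight-line program from a fan-in-two circuit -/

section Extraction

variable [CommSemiring k]

/-- Each entry of `gateValues` is the value of its gate against the earlier entries.
[cite: Burgisser2000, Def. 2.1] -/
theorem getElem?_gateValues (gs : List (Gate k σ)) (i : ℕ) (hi : i < gs.length) :
    (gateValues gs)[i]? = (gs[i]?.map fun g => g.eval ((gateValues gs).take i)) := by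
  induction gs using List.reverseRecOn with
  | nil => simp at hi
  | append_singleton gs g ih =>
    rw [gateValues_append_singleton]
    have hlen := gateValues_length (k := k) gs
    simp only [List.length_append, List.length_singleton] at hi
    by_cases h : i < gs.length
    · rw [List.getElem?_append_left (by omega), List.getElem?_append_left h, ih h,
        List.take_append_of_le_length (by omega)]
    · have hi' : i = gs.length := by omega
      subst hi'
      rw [List.getElem?_append_right (by omega), List.getElem?_append_right le_rfl, hlen]
      simp [List.take_append_of_le_length (le_of_eq hlen.symm),
        List.take_of_length_le (le_of_eq hlen)]

/-- Translation of operands. [cite: Burgisser2000, Def. 2.1] -/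
def toSOperand : Operand k σ → SOperand k σ
  | .var j => .var j
  | .const c => .const c
  | .gate j => .ref j

/-- Translation of fan-in-two gates into lines (missing operands are padded with the constants
`0` / `1`). [cite: Burgisser2000, Def. 2.1] -/
def toSLine : Gate k σ → SLine k σ
  | .sum [] => .lin 0 (.const 0) 0 (.const 0)
  | .sum [a] => .lin a.1 (toSOperand a.2) 0 (.const 0)
  | .sum (a :: b :: _) => .lin a.1 (toSOperand a.2) b.1 (toSOperand b.2)
  | .prod [] => .mul (.const 1) (.const 1)
  | .prod [u] => .mul (toSOperand u) (.const 1)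
  | .prod (u :: w :: _) => .mul (toSOperand u) (toSOperand w)

/-- Translation of operands preserves values (junk references read `0` on both sides). [cite:
Burgisser2000, Def. 2.1] -/
theorem eval_toSOperand (vals : List (MvPolynomial σ k)) (i : ℕ) (_hi : i ≤ vals.length)
    (u : Operand k σ) :
    u.eval (vals.take i) = (toSOperand u).evalAt (fun j => vals.getD j 0) i := by
  cases u with
  | var j => rfl
  | const c => rfl
  | gate j =>
    simp only [Operand.eval, toSOperand, SOperand.evalAt, List.getD_eq_getElem?_getD,
      List.getElem?_take]
    split_ifs <;> rfl

/-- Translation of a fan-in-two gate preserves values. [cite: Burgisser2000, Def. 2.1] -/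
theorem eval_toSLine (vals : List (MvPolynomial σ k)) (i : ℕ) (hi : i ≤ vals.length)
    (g : Gate k σ) (hg : g.fanIn ≤ 2) :
    g.eval (vals.take i) = (toSLine g).evalAt (fun j => vals.getD j 0) i := by
  cases g with
  | sum args =>
    match args, hg with
    | [], _ => simp [Gate.eval, toSLine, SLine.evalAt, SOperand.evalAt]
    | [a], _ => simp [Gate.eval, toSLine, SLine.evalAt, SOperand.evalAt, eval_toSOperand vals i hi]
    | [a, b], _ =>
      simp [Gate.eval, toSLine, SLine.evalAt, eval_toSOperand vals i hi]
    | a :: b :: c :: rest, hg => simp [Gate.fanIn, Gate.args] at hg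
  | prod args =>
    match args, hg with
    | [], _ => simp [Gate.eval, toSLine, SLine.evalAt, SOperand.evalAt]
    | [u], _ => simp [Gate.eval, toSLine, SLine.evalAt, SOperand.evalAt, eval_toSOperand vals i hi]
    | [u, w], _ =>
      simp [Gate.eval, toSLine, SLine.evalAt, eval_toSOperand vals i hi]
    | u :: w :: x :: rest, hg => simp [Gate.fanIn, Gate.args] at hg

/-- The straight-line program of a fan-in-two circuit. [cite: Burgisser2000, Def. 2.1] -/
def slpOf (P : ArithCircuit k σ) (hP : P.IsFanInTwo) : SLP k σ where
  len := P.size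
  line i := (P.gates[i]?.map toSLine).getD (.mul (.const 1) (.const 1))
  val i := (gateValues P.gates).getD i 0
  val_eq := by
    intro i hi
    have hlen := gateValues_length (k := k) P.gates
    unfold size at hi
    obtain ⟨g, hg⟩ : ∃ g, P.gates[i]? = some g := ⟨P.gates[i], List.getElem?_eq_getElem hi⟩
    rw [List.getD_eq_getElem?_getD, getElem?_gateValues _ _ hi, hg]
    simp only [Option.map_some, Option.getD_some]
    exact eval_toSLine _ i (by omega) g (hP g (List.mem_of_getElem? hg))

/-- Extraction: the polynomial computed by a fan-in-two circuit of size `s` is a value of a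
straight-line program of length `s`, or a variable, or a constant.
[cite: Burgisser2000, Def. 2.1] -/
theorem exists_slp (P : ArithCircuit k σ) (hP : P.IsFanInTwo) :
    ∃ S : SLP k σ, S.len = P.size ∧
      ((∃ i, i < S.len ∧ P.eval = S.val i) ∨ (∃ j, P.eval = X j) ∨ (∃ c, P.eval = C c)) := by
  refine ⟨slpOf P hP, rfl, ?_⟩
  unfold ArithCircuit.eval
  cases ho : P.output with
  | var j => exact Or.inr (Or.inl ⟨j, rfl⟩)
  | const c => exact Or.inr (Or.inr ⟨c, rfl⟩)
  | gate j =>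
    by_cases hj : j < P.size
    · exact Or.inl ⟨j, hj, rfl⟩
    · refine Or.inr (Or.inr ⟨0, ?_⟩)
      have hlen := gateValues_length (k := k) P.gates
      simp only [Operand.eval, List.getD_eq_getElem?_getD, map_zero]
      rw [List.getElem?_eq_none (by unfold size at hj; omega)]
      rfl

end Extraction

/-! ### Layered circuits and the `ΣΠΣΠ` builder -/

section Layers

variable [CommSemiring k]

/-- An operand referring below `vals.length` ignores appended values.
[cite: Burgisser2000, Def. 2.1] -/
theorem operand_eval_append_of_refsBelow (vals ws : List (MvPolynomial σ k)) {u : Operand k σ}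
    (hu : u.RefsBelow vals.length) : u.eval (vals ++ ws) = u.eval vals := by
  cases u with
  | var i => rfl
  | const c => rfl
  | gate j =>
    simp only [Operand.RefsBelow] at hu
    simp [Operand.eval, List.getD_eq_getElem?_getD, List.getElem?_append_left hu]

/-- A gate referring below `vals.length` ignores appended values. [cite: Burgisser2000, Def. 2.1] -/
theorem gate_eval_append_of_refsBelow (vals ws : List (MvPolynomial σ k)) {g : Gate k σ}
    (hg : ∀ u ∈ g.args, u.RefsBelow vals.length) : g.eval (vals ++ ws) = g.eval vals := by
  cases g with
  | sum args =>
    simp only [Gate.eval]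
    congr 1
    apply List.map_congr_left
    intro a ha
    rw [operand_eval_append_of_refsBelow _ _ (hg a.2 (by simp [Gate.args]; exact ⟨a.1, ha⟩))]
  | prod args =>
    simp only [Gate.eval]
    congr 1
    apply List.map_congr_left
    intro u hu
    rw [operand_eval_append_of_refsBelow _ _ (hg u hu)]

/-- Values of a layer: if every gate of `B` refers only to gates of `A`, the values of `A ++ B`
are the values of `A` followed by the values of the gates of `B` against those.
[folklore] -/
theorem gateValues_layer (A B : List (Gate k σ))
    (hB : ∀ g ∈ B, ∀ u ∈ g.args, u.RefsBelow A.length) :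
    gateValues (A ++ B) = gateValues A ++ B.map fun g => g.eval (gateValues A) := by
  induction B using List.reverseRecOn with
  | nil => simp
  | append_singleton B g ih =>
    rw [← List.append_assoc, gateValues_append_singleton, ih fun g' hg' => hB g' (by simp [hg'])]
    rw [List.map_append, List.map_singleton, List.append_assoc]
    congr 2
    rw [gate_eval_append_of_refsBelow]
    intro u hu
    rw [gateValues_length]
    exact hB g (by simp) u hu

omit [CommSemiring k] in
/-- Depth of an operand referring below `ds.length` ignores appended depths. [folklore] -/
theorem depthIn_append_of_refsBelow (ds ds' : List ℕ) {u : Operand k σ}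
    (hu : u.RefsBelow ds.length) : u.depthIn (ds ++ ds') = u.depthIn ds := by
  cases u with
  | var i => rfl
  | const c => rfl
  | gate j =>
    simp only [Operand.RefsBelow] at hu
    simp [Operand.depthIn, List.getD_eq_getElem?_getD, List.getElem?_append_left hu]

omit [CommSemiring k] in
/-- Depths of a layer. [folklore] -/
theorem gateWDepths_layer (w : Gate k σ → ℕ) (A B : List (Gate k σ))
    (hB : ∀ g ∈ B, ∀ u ∈ g.args, u.RefsBelow A.length) :
    gateWDepths w (A ++ B) = gateWDepths w A ++
      B.map fun g => w g + ((g.args.map (Operand.depthIn (gateWDepths w A))).foldr max 0) := by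
  induction B using List.reverseRecOn with
  | nil => simp
  | append_singleton B g ih =>
    rw [← List.append_assoc, gateWDepths_append_singleton, ih fun g' hg' => hB g' (by simp [hg'])]
    rw [List.map_append, List.map_singleton, List.append_assoc]
    have hfold : (g.args.map (Operand.depthIn (gateWDepths w A ++ B.map fun g =>
        w g + ((g.args.map (Operand.depthIn (gateWDepths w A))).foldr max 0)))).foldr max 0 =
        (g.args.map (Operand.depthIn (gateWDepths w A))).foldr max 0 := by
      congr 1
      apply List.map_congr_left
      intro u hu
      rw [depthIn_append_of_refsBelow]
      rw [gateWDepths_length]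
      exact hB g (by simp) u hu
    rw [hfold]

/-- `foldr max 0` is bounded by a common bound of the entries. [folklore] -/
theorem foldr_max_le {l : List ℕ} {b : ℕ} (h : ∀ x ∈ l, x ≤ b) : l.foldr max 0 ≤ b := by
  induction l with
  | nil => exact Nat.zero_le _
  | cons a l ih =>
    simp only [List.foldr_cons]
    exact max_le (h a (by simp)) (ih fun x hx => h x (by simp [hx]))

omit [CommSemiring k] in
/-- The depth of an operand is bounded by a common bound of the depth list. [folklore] -/
theorem depthIn_le {ds : List ℕ} {b : ℕ} (h : ∀ x ∈ ds, x ≤ b) (u : Operand k σ) :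
    u.depthIn ds ≤ b := by
  cases u with
  | var i => exact Nat.zero_le _
  | const c => exact Nat.zero_le _
  | gate j =>
    simp only [Operand.depthIn, List.getD_eq_getElem?_getD]
    cases hj : ds[j]? with
    | none => exact Nat.zero_le _
    | some x => exact h x (List.mem_of_getElem? hj)

end Layers

section Builder

variable [CommSemiring k] [DecidableEq σ]

/-- The product gate computing the monomial `X^m`.
[cite: Tavenas2015, §6 (proof of Lemma 3: a monomial is one ×-gate); LST2021, §1] -/
def monomialGate (m : σ →₀ ℕ) : Gate k σ :=
  .prod ((Finsupp.toMultiset m).toList.map Operand.var)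

omit [DecidableEq σ] in
/-- The monomial gate computes `X^m`. [cite: Tavenas2015, §6] -/
theorem eval_monomialGate (vals : List (MvPolynomial σ k)) (m : σ →₀ ℕ) :
    (monomialGate m : Gate k σ).eval vals = monomial m 1 := by
  simp only [monomialGate, Gate.eval, List.map_map]
  have : (Operand.eval vals ∘ Operand.var : σ → MvPolynomial σ k) = X := by
    funext j; rfl
  rw [this, ← Multiset.prod_coe, ← Multiset.map_coe, Multiset.coe_toList,
    Finsupp.toMultiset_map, Finsupp.prod_toMultiset,
    Finsupp.prod_mapDomain_index (fun _ => pow_zero _) (fun _ _ _ => pow_add _ _ _)]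
  exact prod_X_pow_eq_monomial

omit [CommSemiring k] [DecidableEq σ] in
/-- The operands of a monomial gate are variables. [folklore] -/
theorem args_monomialGate (m : σ →₀ ℕ) :
    ∀ u ∈ (monomialGate m : Gate k σ).args, ∃ j, u = Operand.var j := by
  intro u hu
  simp only [monomialGate, Gate.args, List.mem_map] at hu
  obtain ⟨j, -, rfl⟩ := hu
  exact ⟨j, rfl⟩

variable (T W : ℕ) (p : Fin T → Fin W → MvPolynomial σ k) (ms : List (σ →₀ ℕ))

/-- Layer 1: one product gate per monomial of `ms`.
[cite: Tavenas2015, §6 (proof of Lemma 3); LST2021, §1] -/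
def layerM : List (Gate k σ) := ms.map monomialGate

/-- The sum gate computing a piece `q` from the monomial gates (support of `q` inside `ms`).
[cite: Tavenas2015, §6 (proof of Lemma 3: depth-2 circuit of a low-degree gate); LST2021, §1] -/
def pieceGate (q : MvPolynomial σ k) : Gate k σ :=
  .sum ((List.finRange ms.length).map fun μ => (coeff (ms.get μ) q, .gate μ.val))

/-- Layer 2: one sum gate per piece `p τ π`, at index `ms.length + finProdFinEquiv (τ, π)`.
[cite: Tavenas2015, §6; LST2021, §1] -/
def layerP : List (Gate k σ) :=
  (List.finRange (T * W)).map fun q => pieceGate ms (p (finProdFinEquiv.symm q).1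
    (finProdFinEquiv.symm q).2)

/-- Layer 3: one product gate per term. [cite: Tavenas2015, §6; LST2021, §1] -/
def layerT : List (Gate k σ) :=
  (List.finRange T).map fun τ => .prod ((List.finRange W).map fun π =>
    .gate (ms.length + (finProdFinEquiv (τ, π)).val))

/-- Layer 4: the output sum gate. [cite: Tavenas2015, §6; LST2021, §1] -/
def topGate : Gate k σ :=
  .sum ((List.finRange T).map fun τ => (1, .gate (ms.length + T * W + τ.val)))

/-- The `ΣΠΣΠ` circuit computing `Σ_τ Π_π p τ π`.
[cite: Tavenas2015, §2 (ΣΠΣΠ circuits) and §6; LST2021, §1] -/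
def sigmaPiCircuit : ArithCircuit k σ where
  gates := layerM ms ++ layerP T W p ms ++ layerT T W ms ++ [topGate T W ms]
  output := .gate (ms.length + T * W + T)

omit [DecidableEq σ] in
/-- Gate count of the `ΣΠΣΠ` circuit: `#ms + T·W + T + 1`. [cite: Tavenas2015, §6, Lemma 3 (size
count)] -/
theorem size_sigmaPiCircuit :
    (sigmaPiCircuit T W p ms).size = ms.length + T * W + T + 1 := by
  simp only [sigmaPiCircuit, ArithCircuit.size, layerM, layerP, layerT, List.length_append,
    List.length_map, List.length_finRange, List.length_singleton]

omit [CommSemiring k] [DecidableEq σ] in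
/-- Layer 1 has one gate per monomial. [folklore] -/
theorem length_layerM : (layerM ms : List (Gate k σ)).length = ms.length := by simp [layerM]
omit [DecidableEq σ] in
/-- Layer 2 has `T · W` gates. [folklore] -/
theorem length_layerP : (layerP T W p ms).length = T * W := by simp [layerP]
omit [CommSemiring k] [DecidableEq σ] in
/-- Layer 3 has `T` gates. [folklore] -/
theorem length_layerT : (layerT T W ms : List (Gate k σ)).length = T := by simp [layerT]

omit [DecidableEq σ] in
/-- Values of layer 1: the monomials. [folklore] -/
theorem gateValues_layerM :
    gateValues (layerM ms : List (Gate k σ)) = ms.map fun m => monomial m 1 := by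
  have := gateValues_layer (k := k) (σ := σ) [] (layerM ms) (by
    intro g hg u hu
    simp only [layerM, List.mem_map] at hg
    obtain ⟨m, -, rfl⟩ := hg
    obtain ⟨j, rfl⟩ := args_monomialGate m u hu
    trivial)
  simp only [List.nil_append] at this
  rw [this]
  simp [gateValues, layerM, eval_monomialGate]

/-- A piece gate computes its piece (a polynomial is the sum of its monomials). [folklore] -/
theorem eval_pieceGate {q : MvPolynomial σ k} (hnd : ms.Nodup) (hq : q.support ⊆ ms.toFinset) :
    (pieceGate ms q).eval (ms.map fun m => monomial m 1) = q := by
  classical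
  simp only [pieceGate, Gate.eval, List.map_map]
  have hf : ((fun a : k × Operand k σ => a.1 • a.2.eval (ms.map fun m => monomial m 1)) ∘
      fun μ : Fin ms.length => (coeff (ms.get μ) q, Operand.gate μ.val)) =
      fun μ : Fin ms.length => monomial (ms[μ.val]) (coeff (ms[μ.val]) q) := by
    funext μ
    simp [Operand.eval, List.getD_eq_getElem?_getD, smul_monomial]
  rw [hf, ← Fin.sum_univ_def, Fin.sum_univ_fun_getElem ms fun m => monomial m (coeff m q),
    ← List.sum_toFinset _ hnd]
  conv_rhs => rw [← support_sum_monomial_coeff q]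
  symm
  apply Finset.sum_subset hq
  intro m _ hm
  rw [notMem_support_iff.1 hm, monomial_zero]

omit [DecidableEq σ] in
/-- Layer 2 refers only to layer 1. [folklore] -/
theorem refs_layerP : ∀ g ∈ layerP T W p ms, ∀ u ∈ g.args,
    u.RefsBelow (layerM ms : List (Gate k σ)).length := by
  intro g hg u hu
  simp only [layerP, List.mem_map] at hg
  obtain ⟨q, -, rfl⟩ := hg
  simp only [pieceGate, Gate.args, List.map_map, List.mem_map] at hu
  obtain ⟨μ, -, rfl⟩ := hu
  simp only [Function.comp, Operand.RefsBelow, length_layerM]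
  exact μ.isLt

/-- Values of layers 1–2. [folklore] -/
theorem gateValues_layerMP (hnd : ms.Nodup) (hp : ∀ τ π, (p τ π).support ⊆ ms.toFinset) :
    gateValues (layerM ms ++ layerP T W p ms) = (ms.map fun m => monomial m 1) ++
      (List.finRange (T * W)).map fun q => p (finProdFinEquiv.symm q).1
        (finProdFinEquiv.symm q).2 := by
  rw [gateValues_layer _ _ (refs_layerP T W p ms), gateValues_layerM]
  congr 1
  simp only [layerP, List.map_map]
  apply List.map_congr_left
  intro q _
  simp only [Function.comp]
  exact eval_pieceGate ms hnd (hp _ _)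

omit [DecidableEq σ] in
/-- Layer 3 refers only to layers 1–2. [folklore] -/
theorem refs_layerT : ∀ g ∈ (layerT T W ms : List (Gate k σ)), ∀ u ∈ g.args,
    u.RefsBelow (layerM ms ++ layerP T W p ms : List (Gate k σ)).length := by
  intro g hg u hu
  simp only [layerT, List.mem_map] at hg
  obtain ⟨τ, -, rfl⟩ := hg
  simp only [Gate.args, List.mem_map] at hu
  obtain ⟨π, -, rfl⟩ := hu
  simp only [Operand.RefsBelow, List.length_append, length_layerM, length_layerP]
  have := (finProdFinEquiv (τ, π)).isLt
  omega

/-- Values of layers 1–3. [folklore] -/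
theorem gateValues_layerMPT (hnd : ms.Nodup) (hp : ∀ τ π, (p τ π).support ⊆ ms.toFinset) :
    gateValues (layerM ms ++ layerP T W p ms ++ layerT T W ms) =
      ((ms.map fun m => monomial m 1) ++
      (List.finRange (T * W)).map fun q => p (finProdFinEquiv.symm q).1
        (finProdFinEquiv.symm q).2) ++
      (List.finRange T).map fun τ => ∏ π : Fin W, p τ π := by
  rw [gateValues_layer _ _ (refs_layerT T W p ms), gateValues_layerMP T W p ms hnd hp]
  congr 1
  simp only [layerT, List.map_map]
  apply List.map_congr_left
  intro τ _
  simp only [Function.comp, Gate.eval, List.map_map]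
  rw [← Fin.prod_univ_def]
  apply Fintype.prod_congr
  intro π
  simp only [Function.comp, Operand.eval, List.getD_eq_getElem?_getD]
  rw [List.getElem?_append_right (by simp), List.length_map, Nat.add_sub_cancel_left,
    List.getElem?_map, List.getElem?_eq_getElem (by
      rw [List.length_finRange]; exact (finProdFinEquiv (τ, π)).isLt)]
  simp only [List.getElem_finRange, Fin.cast_mk, Option.map_some, Option.getD_some, Fin.eta,
    Equiv.symm_apply_apply]

/-- The `ΣΠΣΠ` circuit computes `Σ_τ Π_π p τ π`. [cite: Tavenas2015, §2 (ΣΠΣΠ circuits)] -/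
theorem eval_sigmaPiCircuit (hnd : ms.Nodup) (hp : ∀ τ π, (p τ π).support ⊆ ms.toFinset) :
    (sigmaPiCircuit T W p ms).eval = ∑ τ : Fin T, ∏ π : Fin W, p τ π := by
  have hrefs : ∀ g ∈ ([topGate T W ms] : List (Gate k σ)), ∀ u ∈ g.args,
      u.RefsBelow (layerM ms ++ layerP T W p ms ++ layerT T W ms : List (Gate k σ)).length := by
    intro g hg u hu
    simp only [List.mem_singleton] at hg
    subst hg
    simp only [topGate, Gate.args, List.map_map, List.mem_map] at hu
    obtain ⟨τ, -, rfl⟩ := hu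
    simp only [Function.comp, Operand.RefsBelow, List.length_append, length_layerM, length_layerP,
      length_layerT]
    omega
  simp only [sigmaPiCircuit, ArithCircuit.eval]
  rw [gateValues_layer _ _ hrefs, gateValues_layerMPT T W p ms hnd hp]
  set vM := ms.map fun m => (monomial m) (1 : k) with hvM
  set vP := (List.finRange (T * W)).map fun q => p (finProdFinEquiv.symm q).1
    (finProdFinEquiv.symm q).2 with hvP
  set vT := (List.finRange T).map fun τ => ∏ π : Fin W, p τ π with hvT
  have hlM : vM.length = ms.length := by simp [hvM]
  have hlP : vP.length = T * W := by simp [hvP]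
  have hlT : vT.length = T := by simp [hvT]
  have hl3 : (vM ++ vP ++ vT).length = ms.length + T * W + T := by
    rw [List.length_append, List.length_append, hlM, hlP, hlT]
  have hl2 : (vM ++ vP).length = ms.length + T * W := by
    rw [List.length_append, hlM, hlP]
  simp only [List.map_singleton, Operand.eval, List.getD_eq_getElem?_getD]
  rw [List.getElem?_append_right (le_of_eq hl3), hl3, Nat.sub_self]
  simp only [List.getElem?_cons_zero, Option.getD_some, topGate, Gate.eval, List.map_map]
  rw [← Fin.sum_univ_def]
  apply Fintype.sum_congr
  intro τ
  simp only [Function.comp, Operand.eval, List.getD_eq_getElem?_getD, one_smul]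
  rw [List.getElem?_append_right (by rw [hl2]; omega), hl2, Nat.add_sub_cancel_left, hvT,
    List.getElem?_map, List.getElem?_eq_getElem (by simp)]
  simp

/-- All entries of a list are `≤ b`. [folklore] -/
def AllLe (b : ℕ) (l : List ℕ) : Prop := ∀ x ∈ l, x ≤ b

omit [DecidableEq σ] in
/-- The output gate refers only to layers 1–3. [folklore] -/
theorem refs_top : ∀ g ∈ ([topGate T W ms] : List (Gate k σ)), ∀ u ∈ g.args,
    u.RefsBelow (layerM ms ++ layerP T W p ms ++ layerT T W ms : List (Gate k σ)).length := by
  intro g hg u hu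
  simp only [List.mem_singleton] at hg
  subst hg
  simp only [topGate, Gate.args, List.map_map, List.mem_map] at hu
  obtain ⟨τ, -, rfl⟩ := hu
  simp only [Function.comp, Operand.RefsBelow, List.length_append, length_layerM, length_layerP,
    length_layerT]
  omega

omit [CommSemiring k] [DecidableEq σ] in
/-- Layer 1 refers to no gate. [folklore] -/
theorem refs_layerM : ∀ g ∈ (layerM ms : List (Gate k σ)), ∀ u ∈ g.args,
    u.RefsBelow ([] : List (Gate k σ)).length := by
  intro g hg u hu
  simp only [layerM, List.mem_map] at hg
  obtain ⟨m, -, rfl⟩ := hg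
  obtain ⟨j, rfl⟩ := args_monomialGate m u hu
  trivial

omit [DecidableEq σ] in
/-- The `ΣΠΣΠ` circuit has product-depth `≤ 2` (LST 2021 §1: a `ΣΠΣΠ` circuit has `Δ = 2`). [cite:
LST2021, §1] -/
theorem productDepth_sigmaPiCircuit_le : (sigmaPiCircuit T W p ms).productDepth ≤ 2 := by
  unfold ArithCircuit.productDepth ArithCircuit.wdepth
  generalize hw : (fun g : Gate k σ => if g.isProd then 1 else 0) = w
  have hw_prod : ∀ args, w (.prod args) = 1 := fun _ => by rw [← hw]; rfl
  have hw_sum : ∀ args, w (.sum args) = 0 := fun _ => by rw [← hw]; rfl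
  have h1 : AllLe 1 (gateWDepths w (layerM ms : List (Gate k σ))) := by
    have := gateWDepths_layer w [] (layerM ms) (refs_layerM ms)
    simp only [List.nil_append] at this
    rw [this]
    intro x hx
    simp only [gateWDepths, List.foldl_nil, List.nil_append, List.mem_map] at hx
    obtain ⟨g, hg, rfl⟩ := hx
    simp only [layerM, List.mem_map] at hg
    obtain ⟨m, -, rfl⟩ := hg
    have h0 : ((monomialGate m : Gate k σ).args.map
        (Operand.depthIn ([] : List ℕ))).foldr max 0 ≤ 0 :=
      foldr_max_le fun x hx => by
        obtain ⟨u, hu, rfl⟩ := List.mem_map.1 hx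
        obtain ⟨j, rfl⟩ := args_monomialGate m u hu
        exact le_rfl
    have hwm : w (monomialGate m : Gate k σ) = 1 := hw_prod _
    omega
  have h2 : AllLe 1 (gateWDepths w (layerM ms ++ layerP T W p ms)) := by
    rw [gateWDepths_layer w _ _ (refs_layerP T W p ms)]
    intro x hx
    rcases List.mem_append.1 hx with hx | hx
    · exact h1 x hx
    · simp only [List.mem_map] at hx
      obtain ⟨g, hg, rfl⟩ := hx
      simp only [layerP, List.mem_map] at hg
      obtain ⟨q, -, rfl⟩ := hg
      rw [pieceGate, hw_sum, zero_add]
      exact foldr_max_le fun x hx => by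
        obtain ⟨u, -, rfl⟩ := List.mem_map.1 hx
        exact depthIn_le h1 u
  have h3 : AllLe 2 (gateWDepths w (layerM ms ++ layerP T W p ms ++ layerT T W ms)) := by
    rw [gateWDepths_layer w _ _ (refs_layerT T W p ms)]
    intro x hx
    rcases List.mem_append.1 hx with hx | hx
    · exact (h2 x hx).trans (by norm_num)
    · simp only [List.mem_map] at hx
      obtain ⟨g, hg, rfl⟩ := hx
      simp only [layerT, List.mem_map] at hg
      obtain ⟨τ, -, rfl⟩ := hg
      rw [hw_prod]
      have := foldr_max_le (b := 1) (l := ((Gate.prod ((List.finRange W).map fun π =>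
        Operand.gate (ms.length + (finProdFinEquiv (τ, π)).val)) : Gate k σ).args.map
          (Operand.depthIn (gateWDepths w (layerM ms ++ layerP T W p ms))))) fun x hx => by
        obtain ⟨u, -, rfl⟩ := List.mem_map.1 hx
        exact depthIn_le h2 u
      omega
  have h4 : AllLe 2 (gateWDepths w (sigmaPiCircuit T W p ms).gates) := by
    simp only [sigmaPiCircuit]
    rw [gateWDepths_layer w _ _ (refs_top T W p ms)]
    intro x hx
    rcases List.mem_append.1 hx with hx | hx
    · exact h3 x hx
    · simp only [List.map_singleton, List.mem_singleton] at hx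
      subst hx
      rw [topGate, hw_sum, zero_add]
      exact foldr_max_le fun x hx => by
        obtain ⟨u, -, rfl⟩ := List.mem_map.1 hx
        exact depthIn_le h3 u
  exact depthIn_le h4 _

/-- **The `ΣΠΣΠ` builder.** `Σ_{τ < T} Π_{π < W} p τ π`, with all supports inside a finite set
`U` of monomials, has an unbounded-fan-in circuit of product-depth `≤ 2` with
`#U + T · W + T + 1` gates. [cite: LST2021, §1; Tavenas2015, §6, Lemma 3] -/
theorem exists_circuit_sum_prod (U : Finset (σ →₀ ℕ)) (hp : ∀ τ π, (p τ π).support ⊆ U) :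
    ∃ C : ArithCircuit k σ, C.eval = ∑ τ : Fin T, ∏ π : Fin W, p τ π ∧ C.productDepth ≤ 2 ∧
      C.size = U.card + T * W + T + 1 := by
  refine ⟨sigmaPiCircuit T W p U.toList, ?_, productDepth_sigmaPiCircuit_le T W p _, ?_⟩
  · exact eval_sigmaPiCircuit T W p _ (Finset.nodup_toList U) (by simpa using hp)
  · rw [size_sigmaPiCircuit, Finset.length_toList]

end Builder

end Literature.Computability.AlgebraicComplexity.DepthReduction

/-! ## Monomial counting, assembly, arithmetic -/

namespace Literature.Computability.AlgebraicComplexity.DepthReduction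

universe u v

variable {k : Type u} [CommSemiring k] {σ : Type v}

/-! ### Counting monomials of bounded degree -/

/-- The number of monomials of degree `≤ t` in `N` variables is at most `(t + 1) (N + t)^t`
(for `t ≥ 1`). [cite: Tavenas2015, §6 (binom(n + d/a, d/a) monomials) and Lemma 4] -/
theorem card_le_of_degree_le [Fintype σ] [DecidableEq σ] (U : Finset (σ →₀ ℕ)) {t : ℕ}
    (ht : 1 ≤ t) (hU : ∀ m ∈ U, (m.sum fun _ e => e) ≤ t) :
    U.card ≤ (t + 1) * (Fintype.card σ + t) ^ t := by
  let V : Finset (Multiset σ) := (Finset.range (t + 1)).biUnion fun e =>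
    (Finset.univ : Finset (Sym σ e)).image fun s : Sym σ e => (s : Multiset σ)
  have hmaps : ∀ m ∈ U, Finsupp.toMultiset m ∈ V := by
    intro m hm
    simp only [V, Finset.mem_biUnion, Finset.mem_range, Finset.mem_image, Finset.mem_univ,
      true_and]
    refine ⟨(Finsupp.toMultiset m).card, ?_, Sym.mk (Finsupp.toMultiset m) rfl, rfl⟩
    rw [Finsupp.card_toMultiset]
    exact Nat.lt_succ_of_le (hU m hm)
  have hinj : Set.InjOn (fun m : σ →₀ ℕ => Finsupp.toMultiset m) U := by
    intro m _ m' _ h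
    have := congrArg Multiset.toFinsupp h
    simpa [Finsupp.toMultiset_toFinsupp] using this
  refine (Finset.card_le_card_of_injOn _ hmaps hinj).trans ?_
  refine (Finset.card_biUnion_le).trans ?_
  calc ∑ e ∈ Finset.range (t + 1), ((Finset.univ : Finset (Sym σ e)).image
        fun s : Sym σ e => (s : Multiset σ)).card
      ≤ ∑ _e ∈ Finset.range (t + 1), (Fintype.card σ + t) ^ t := by
        apply Finset.sum_le_sum
        intro e he
        simp only [Finset.mem_range] at he
        refine Finset.card_image_le.trans ?_
        rw [Finset.card_univ, Sym.card_sym_eq_choose]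
        refine (Nat.choose_le_pow _ _).trans ?_
        calc (Fintype.card σ + e - 1) ^ e ≤ (Fintype.card σ + t) ^ e :=
              Nat.pow_le_pow_left (by omega) _
          _ ≤ (Fintype.card σ + t) ^ t := Nat.pow_le_pow_right (by omega) (by omega)
    _ = (t + 1) * (Fintype.card σ + t) ^ t := by simp

/-! ### Padding products -/

/-- A product over `Fin W` of the entries of a list padded with `1`. [folklore] -/
theorem prod_getD_one {M : Type*} [CommMonoid M] : ∀ (l : List M) (W : ℕ), l.length ≤ W →
    ∏ π : Fin W, l.getD π.val 1 = l.prod := by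
  intro l
  induction l with
  | nil => intro W _; simp
  | cons a l ih =>
    intro W hW
    obtain ⟨W, rfl⟩ : ∃ W', W = W' + 1 := ⟨W - 1, by simp at hW; omega⟩
    rw [Fin.prod_univ_succ]
    simp only [Fin.val_zero, List.getD_cons_zero, Fin.val_succ, List.getD_cons_succ,
      List.prod_cons]
    rw [ih W (by simp at hW; omega)]

/-- An entry of a list padded with `1` is an entry of the list or `1`. [folklore] -/
theorem getD_one_mem_or {M : Type*} [One M] (l : List M) (n : ℕ) :
    l.getD n 1 ∈ l ∨ l.getD n 1 = 1 := by
  rw [List.getD_eq_getElem?_getD]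
  cases h : l[n]? with
  | none => right; rfl
  | some x => left; exact List.mem_of_getElem? h

/-! ### Assembly for one polynomial -/

/-- The gate bound of the assembled circuit. [cite: Tavenas2015, §6, Lemma 3 (size 1 +
binom(σ+15a,15a) + σ + σ·binom(n+d/a,d/a) + n), our constants] -/
def sizeBound (N d s t : ℕ) : ℕ :=
  (t + 1) * (N + t) ^ t +
    ((d + 1) * ((4 * s * (d + 1) ^ 2) * (4 * s * (d + 1) ^ 2)) ^ (8 * d / (t + 1))) *
      (1 + 4 * (8 * d / (t + 1))) +
    (d + 1) * ((4 * s * (d + 1) ^ 2) * (4 * s * (d + 1) ^ 2)) ^ (8 * d / (t + 1)) + 1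

/-- A value of a straight-line program of length `s`, of total degree `≤ d`, over `N` variables,
has a product-depth-`2` circuit with at most `sizeBound N d s t` gates (`t ≥ 1`).
[cite: Tavenas2015, Thm. 1 and Lemma 3; AgrawalVinay2008] -/
theorem exists_circuit_of_slp [Fintype σ] [DecidableEq σ] (S : SLP k σ) {i : ℕ} (hi : i < S.len)
    {d t : ℕ} (hd : (S.val i).totalDegree ≤ d) (ht : 1 ≤ t) :
    ∃ C : ArithCircuit k σ, C.eval = S.val i ∧ C.productDepth ≤ 2 ∧
      C.size ≤ sizeBound (Fintype.card σ) d S.len t := by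
  obtain ⟨L, hsum, hlen, hT⟩ := S.exists_sum_prod d ht hi hd
  set W := 1 + 4 * (8 * d / (t + 1)) with hW
  let p : Fin L.length → Fin W → MvPolynomial σ k := fun τ π => (L[τ.val]).getD π.val 1
  let U : Finset (σ →₀ ℕ) := (Finset.univ : Finset (Fin L.length × Fin W)).biUnion
    fun x => (p x.1 x.2).support
  have hp : ∀ τ π, (p τ π).support ⊆ U := fun τ π =>
    Finset.subset_biUnion_of_mem (fun x : Fin L.length × Fin W => (p x.1 x.2).support)
      (Finset.mem_univ (τ, π))
  obtain ⟨C, hC, hpd, hsize⟩ := exists_circuit_sum_prod L.length W p U hp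
  refine ⟨C, ?_, hpd, ?_⟩
  · rw [hC, ← hsum]
    have : ∀ τ : Fin L.length, ∏ π : Fin W, p τ π = (L[τ.val]).prod := fun τ =>
      prod_getD_one _ W (hT _ (List.getElem_mem _)).1
    simp only [this]
    exact Fin.sum_univ_fun_getElem L List.prod
  · rw [hsize, sizeBound]
    have hU : U.card ≤ (t + 1) * (Fintype.card σ + t) ^ t := by
      apply card_le_of_degree_le U ht
      intro m hm
      simp only [U, Finset.mem_biUnion, Finset.mem_univ, true_and] at hm
      obtain ⟨⟨τ, π⟩, hm⟩ := hm
      refine (le_totalDegree hm).trans ?_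
      rcases getD_one_mem_or (L[τ.val]) π.val with h | h
      · exact (hT _ (List.getElem_mem _)).2 _ h
      · simp only [p] at hm ⊢
        rw [h, totalDegree_one]
        exact Nat.zero_le _
    have hLW : L.length * W ≤ ((d + 1) * ((4 * S.len * (d + 1) ^ 2) *
        (4 * S.len * (d + 1) ^ 2)) ^ (8 * d / (t + 1))) * W := Nat.mul_le_mul_right _ hlen
    rw [← hW]
    omega

/-! ### Arithmetic -/

/-- `x ≤ n^i + i` with `i ≤ a` gives `x ≤ 2 (n + 2)^a`. [folklore] -/
theorem le_two_mul_pow {x n a i : ℕ} (hx : x ≤ n ^ i + i) (hi : i ≤ a) :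
    x ≤ 2 * (n + 2) ^ a := by
  have h1 : n ^ i ≤ (n + 2) ^ a :=
    (Nat.pow_le_pow_left (by omega) i).trans (Nat.pow_le_pow_right (by omega) hi)
  have h2 : i ≤ (n + 2) ^ a :=
    (hi.trans (Nat.lt_two_pow_self).le).trans (Nat.pow_le_pow_left (by omega) a)
  omega

/-- `4 B^a ≤ B^(a+2)` for `B ≥ 2`. [folklore] -/
theorem four_mul_pow_le (B a : ℕ) (hB : 2 ≤ B) : 4 * B ^ a ≤ B ^ (a + 2) := by
  rw [pow_add]
  have : 4 ≤ B ^ 2 := by nlinarith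
  nlinarith [Nat.zero_le (B ^ a)]

/-- The final arithmetic: the assembled gate bound is at most `B ^ ((48 E + 32) t + (50 E + 40))`.
[cite: Tavenas2015, proof of Thm. 1 (2^{O(√(d log(ds) log n))}) specialised to p-bounded s, d, n] -/
theorem sizeBound_le {B E t N d s : ℕ} (hB : 2 ≤ B) (ht1 : t + 1 ≤ B ^ E) (hNt : N + t ≤ B ^ E)
    (hd1 : d + 1 ≤ B ^ E) (hs : s ≤ B ^ E) (hdt : d < (t + 1) * (t + 1)) :
    sizeBound N d s t ≤ B ^ ((48 * E + 32) * t + (50 * E + 40)) := by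
  have hB1 : 1 ≤ B := by omega
  have hR : 8 * d / (t + 1) ≤ 8 * (t + 1) := by
    apply (Nat.div_le_div_right (Nat.mul_le_mul_left 8 hdt.le)).trans
    rw [show 8 * ((t + 1) * (t + 1)) = 8 * (t + 1) * (t + 1) by ring,
      Nat.mul_div_cancel _ (by omega)]
  have hU : (t + 1) * (N + t) ^ t ≤ B ^ (E + E * t) := by
    rw [pow_add, pow_mul]
    gcongr
  have hS1 : 4 * s * (d + 1) ^ 2 ≤ B ^ (3 * E + 2) := by
    calc 4 * s * (d + 1) ^ 2 ≤ 4 * B ^ E * (B ^ E) ^ 2 := by gcongr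
      _ = 4 * B ^ (3 * E) := by ring
      _ ≤ B ^ (3 * E + 2) := four_mul_pow_le B _ hB
  have hS2 : (4 * s * (d + 1) ^ 2) * (4 * s * (d + 1) ^ 2) ≤ B ^ (6 * E + 4) := by
    calc (4 * s * (d + 1) ^ 2) * (4 * s * (d + 1) ^ 2) ≤ B ^ (3 * E + 2) * B ^ (3 * E + 2) :=
          Nat.mul_le_mul hS1 hS1
      _ = B ^ (6 * E + 4) := by rw [← pow_add]; ring_nf
  have hpow : ((4 * s * (d + 1) ^ 2) * (4 * s * (d + 1) ^ 2)) ^ (8 * d / (t + 1)) ≤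
      B ^ ((48 * E + 32) * (t + 1)) := by
    calc ((4 * s * (d + 1) ^ 2) * (4 * s * (d + 1) ^ 2)) ^ (8 * d / (t + 1))
        ≤ (B ^ (6 * E + 4)) ^ (8 * d / (t + 1)) := Nat.pow_le_pow_left hS2 _
      _ ≤ (B ^ (6 * E + 4)) ^ (8 * (t + 1)) :=
          Nat.pow_le_pow_right (Nat.pow_pos (by omega)) hR
      _ = B ^ ((48 * E + 32) * (t + 1)) := by rw [← pow_mul]; ring_nf
  have hTn : (d + 1) * ((4 * s * (d + 1) ^ 2) * (4 * s * (d + 1) ^ 2)) ^ (8 * d / (t + 1)) ≤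
      B ^ (E + (48 * E + 32) * (t + 1)) := by
    rw [pow_add]
    exact Nat.mul_le_mul hd1 hpow
  have hW : 1 + 4 * (8 * d / (t + 1)) ≤ B ^ (E + 6) := by
    have h64 : 64 ≤ B ^ 6 := by
      calc 64 = 2 ^ 6 := by norm_num
        _ ≤ B ^ 6 := Nat.pow_le_pow_left hB 6
    calc 1 + 4 * (8 * d / (t + 1)) ≤ 33 * (t + 1) := by omega
      _ ≤ B ^ 6 * B ^ E := Nat.mul_le_mul (by omega) ht1
      _ = B ^ (E + 6) := by rw [← pow_add, Nat.add_comm]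
  set X := 2 * E + 6 + (48 * E + 32) * (t + 1) with hX
  have hBX : ∀ {e}, e ≤ X → B ^ e ≤ B ^ X := fun he => Nat.pow_le_pow_right hB1 he
  have hterm1 : (t + 1) * (N + t) ^ t ≤ B ^ X :=
    hU.trans (hBX (by rw [hX]; nlinarith [Nat.zero_le E, Nat.zero_le t]))
  have hterm2 : (d + 1) * ((4 * s * (d + 1) ^ 2) * (4 * s * (d + 1) ^ 2)) ^ (8 * d / (t + 1)) *
      (1 + 4 * (8 * d / (t + 1))) ≤ B ^ X := by
    calc _ ≤ B ^ (E + (48 * E + 32) * (t + 1)) * B ^ (E + 6) := Nat.mul_le_mul hTn hW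
      _ = B ^ X := by rw [← pow_add, hX]; ring_nf
  have hterm3 : (d + 1) * ((4 * s * (d + 1) ^ 2) * (4 * s * (d + 1) ^ 2)) ^ (8 * d / (t + 1)) ≤
      B ^ X := hTn.trans (hBX (by rw [hX]; omega))
  have hterm4 : 1 ≤ B ^ X := Nat.one_le_pow _ _ hB1
  calc sizeBound N d s t ≤ B ^ X + B ^ X + B ^ X + B ^ X := by
        unfold sizeBound
        exact Nat.add_le_add (Nat.add_le_add (Nat.add_le_add hterm1 hterm2) hterm3) hterm4
    _ = 4 * B ^ X := by ring
    _ ≤ B ^ (X + 2) := four_mul_pow_le B X hB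
    _ = B ^ ((48 * E + 32) * t + (50 * E + 40)) := by
        congr 1
        rw [hX]
        ring

/-! ### The theorem -/

omit [CommSemiring k] in
/-- A constant has product-depth `0`. [cite: LST2021, §1] -/
theorem productDepth_ofConst (c : k) :
    (ArithCircuit.ofConst c : ArithCircuit k σ).productDepth = 0 :=
  rfl

omit [CommSemiring k] in
/-- A variable has product-depth `0`. [cite: LST2021, §1] -/
theorem productDepth_ofVar (j : σ) : (ArithCircuit.ofVar j : ArithCircuit k σ).productDepth = 0 :=
  rfl


/-- **Tavenas' depth reduction for `VP` families**, over any commutative semiring: for a `VP`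
family `f` there is `c` with `productDepthCircuitSize 2 (f n) ≤ (n + 2) ^ (c ⌊√deg fₙ⌋ + c)`
for all `n` (Tavenas 2015, Thm. 1; Agrawal–Vinay 2008; here via the gate-quotient normal form of
Valiant–Skyum–Berkowitz–Rackoff and the Agrawal–Vinay expansion).
[cite: Tavenas2015, Thm. 1; AgrawalVinay2008; ValiantSkyumBerkowitzRackoff1983] -/
theorem productDepthCircuitSize_two_le {σ : ℕ → Type v} [∀ n, Fintype (σ n)]
    (f : ∀ n, MvPolynomial (σ n) k) (hf : IsVPFamily f) :
    ∃ c : ℕ, ∀ n : ℕ,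
      productDepthCircuitSize 2 (f n) ≤
        ((n + 2 : ℕ∞) ^ (c * Nat.sqrt ((f n).totalDegree) + c)) := by
  classical
  obtain ⟨⟨⟨a1, h1⟩, ⟨a2, h2⟩⟩, ⟨a3, h3⟩⟩ := hf
  set a := a1 + a2 + a3 with ha
  set E := a + 2 with hE
  refine ⟨50 * E + 40, fun n => ?_⟩
  set B := n + 2 with hB
  set g := f n with hg
  set d := g.totalDegree with hd
  set t := Nat.sqrt d with htd
  -- a circuit of size ≤ B ^ ((48E+32) t + (50E+40))
  suffices hC : ∃ C : ArithCircuit k (σ n), C.eval = g ∧ C.productDepth ≤ 2 ∧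
      C.size ≤ B ^ ((48 * E + 32) * t + (50 * E + 40)) by
    obtain ⟨C, hCe, hCd, hCs⟩ := hC
    refine (productDepthCircuitSize_le hCe hCd).trans ?_
    have h50 : (48 * E + 32) * t + (50 * E + 40) ≤ (50 * E + 40) * t + (50 * E + 40) := by
      nlinarith [Nat.zero_le E, Nat.zero_le t]
    have := hCs.trans (Nat.pow_le_pow_right (by omega) h50)
    calc (C.size : ℕ∞) ≤ ((B ^ ((50 * E + 40) * t + (50 * E + 40)) : ℕ) : ℕ∞) := by
          exact_mod_cast this
      _ = ((n + 2 : ℕ∞) ^ ((50 * E + 40) * t + (50 * E + 40))) := by push_cast [hB]; ring_nf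
  have hBpos : 1 ≤ B ^ ((48 * E + 32) * t + (50 * E + 40)) := Nat.one_le_pow _ _ (by omega)
  by_cases hd0 : d = 0
  · refine ⟨ArithCircuit.ofConst (g.coeff 0), ?_, by rw [productDepth_ofConst]; norm_num, ?_⟩
    · rw [ArithCircuit.eval_ofConst]; exact (totalDegree_eq_zero_iff_eq_C.1 hd0).symm
    · rw [ArithCircuit.size_ofConst]; exact Nat.zero_le _
  have ht : 1 ≤ t := by rw [htd, Nat.le_sqrt]; omega
  obtain ⟨P, hfan, hcomp, hsize⟩ := ArithCircuit.exists_computes_size_eq_complexity g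
  obtain ⟨S, hlen, hcases⟩ := exists_slp P hfan
  rw [show P.eval = g from hcomp] at hcases
  rcases hcases with ⟨i, hi, hgi⟩ | ⟨j, hgj⟩ | ⟨c, hgc⟩
  · have hdi : (S.val i).totalDegree ≤ d := by rw [← hgi]
    obtain ⟨C, hCe, hCd, hCs⟩ := exists_circuit_of_slp S hi hdi ht
    refine ⟨C, hCe.trans hgi.symm, hCd, hCs.trans ?_⟩
    have hN : Fintype.card (σ n) ≤ 2 * B ^ a := le_two_mul_pow (h1 n) (by omega)
    have hdd : d ≤ 2 * B ^ a := le_two_mul_pow (h2 n) (by omega)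
    have hs : S.len ≤ 2 * B ^ a := by
      rw [hlen, hsize]; exact le_two_mul_pow (h3 n) (by omega)
    have h4 := four_mul_pow_le B a (by omega)
    have htle : t ≤ d := Nat.sqrt_le_self d
    apply sizeBound_le (B := B) (E := E) (by omega)
    · rw [hE]; omega
    · rw [hE]; omega
    · rw [hE]; omega
    · rw [hE]; omega
    · exact Nat.lt_succ_sqrt d
  · refine ⟨ArithCircuit.ofVar j, ?_, by rw [productDepth_ofVar]; norm_num, ?_⟩
    · rw [ArithCircuit.eval_ofVar, hgj]
    · rw [ArithCircuit.size_ofVar]; exact Nat.zero_le _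
  · refine ⟨ArithCircuit.ofConst c, ?_, by rw [productDepth_ofConst]; norm_num, ?_⟩
    · rw [ArithCircuit.eval_ofConst, hgc]
    · rw [ArithCircuit.size_ofConst]; exact Nat.zero_le _

end Literature.Computability.AlgebraicComplexity.DepthReduction

/-- **Discharge** of the named fact `Literature.Computability.AlgebraicComplexity.productDepthCircuitSize_two_le_of_isVPFamily`
(Tavenas 2015, Thm. 1, for `VP` families over `ℂ`). [cite: Tavenas2015, Thm. 1; AgrawalVinay2008] -/
theorem Literature.Computability.AlgebraicComplexity.productDepthCircuitSize_two_le_of_isVPFamily_holds :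
    Literature.Computability.AlgebraicComplexity.productDepthCircuitSize_two_le_of_isVPFamily :=
  fun f hf => Literature.Computability.AlgebraicComplexity.DepthReduction.productDepthCircuitSize_two_le f hf
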